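import Summits.AtomisticToContinuum.BoseEinsteinCondensation.Theorems.BECThomsonPrincipleGDTransferSeededBandEmptinessBdd
import Summits.AtomisticToContinuum.BoseEinsteinCondensation.Theorems.BECThomsonPrincipleGDTransferSeededPairPotentialBound
import Summits.AtomisticToContinuum.BoseEinsteinCondensation.Theorems.BECThomsonPrincipleGDTransferSeededDilationL1
import Summits.AtomisticToContinuum.BoseEinsteinCondensation.Theorems.BECThomsonPrincipleGDTransferSeededScaledCloseBdd
import Summits.AtomisticToContinuum.BoseEinsteinCondensation.Theorems.BECThomsonPrincipleGDTransferSeededLocalConstancyBdd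

/-!
# Route `BECThomsonPrinciple`, crux `GDTransfer` (stmt-AtomisticToContinuum-9482), line `seeded-continuity` —
# skeleton v6 CLOSED modulo the seed and the singular rest: periodic BEC for every essentially bounded profile

Supports (does not close) stmt-AtomisticToContinuum-9482.  Composition file of skeleton v6 (lead c3): the five
device / twin stubs of the measurable-transport re-cut are LANDED —
`stub_bandEmptinessBdd` (p156581, over …PlainFormsBdd p155428, …PlainPairsBdd p155772, …PlainInteractionBdd p156106,
…PlainPairCostBdd p156362), `stub_pairPotentialBound` (p155726, over …TorusSobolev p155370: periodic `H¹ ⊂ L⁶` on the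
3-torus), `stub_dilationL1` (p155496), `stub_scaledCloseBdd` (p155191), `stub_localConstancyBdd` (p155201) — so the glue
`GDTransfer_of_transport` (…SeededTransportDefs p153539) specialises to:

* `bounded_periodicBEC_of_seed` — **given the seed, Gaussian domination implies periodic BEC for EVERY BOUNDED
  MEASURABLE admissible profile** (soft spheres, square wells, every discontinuous bounded profile; v5 had this only
  for finite continuous profiles, `soft_periodicBEC_of_seed` p145164);
* `essBounded_periodicBEC_of_seed` — the same for every ESSENTIALLY bounded admissible profile (truncation at the
  essential bound + the landed null-modification invariance `stub_roughNull` p148481);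
* `GDTransfer_of_seed_of_singularRest` — **the crux from the two remaining registered stubs**: the SEED
  `stub_noBalancedCat` and the singular rest `stub_singularRest` (hard cores on positive measure, essentially unbounded
  profiles);
* `essentiallyRough_of_singularRest` — v6 refines v5: the v5 rest stub `stub_essentiallyRough` follows from the v6 rest
  stub alone (the seed and GD it needs are among its own hypotheses).

No `sorry`, no new definitions; the two open statements enter only as hypotheses.
-/

noncomputable section

open MeasureTheory Filter
open scoped ENNReal NNReal

namespace Summit.AtomisticToContinuum.BoseEinsteinCondensation.Cruxes.GDTransfer.Seeded

open Literature.MathematicalPhysics.QuantumManyBody.BoseGas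
open Summit.AtomisticToContinuum.BoseEinsteinCondensation.Theses.BECThomsonPrinciple
open Summit.AtomisticToContinuum.BoseEinsteinCondensation.Cruxes.GDTransfer.DysonDressedWitness
  (PeriodicBECFor gdTransfer_iff)

/-- **Given the seed, Gaussian domination implies periodic BEC for every bounded measurable admissible profile**
(the connectedness assembly `stub_ivtGlue` over the landed count law, band emptiness for bounded profiles, free
corner and local constancy by the measurable transport). -/
theorem bounded_periodicBEC_of_seed (hSeed : Sig.stub_noBalancedCat) (hG : GaussianDominationCan) :
    ∀ v : ℝ → ℝ≥0∞, IsRepulsiveFiniteRange v → IsBoundedProfile v → PeriodicBECFor v :=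
  fun v hv hb => stub_ivtGlue stub_countLaw hSeed v hv (stub_bandEmptinessBdd hG v hv hb) (stub_freeCorner v hv)
    (stub_localConstancyBdd (stub_scaledCloseBdd stub_pairPotentialBound stub_dilationL1) stub_countLaw v hv hb)

/-- **… and for every essentially bounded admissible profile** (it is a null modification of its truncation at the
essential bound, which is bounded measurable admissible; `stub_roughNull`). -/
theorem essBounded_periodicBEC_of_seed (hSeed : Sig.stub_noBalancedCat) (hG : GaussianDominationCan) :
    ∀ v : ℝ → ℝ≥0∞, IsRepulsiveFiniteRange v → IsEssBoundedProfile v → PeriodicBECFor v := by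
  intro v hv hess
  obtain ⟨B, hB⟩ := hess
  obtain ⟨hw, hwb⟩ := isRepulsiveFiniteRange_min hv B
  have hae : ∀ᵐ x : Space, v ‖x‖ = min (v ‖x‖) (ENNReal.ofReal B) :=
    hB.mono fun x hx => (min_eq_left hx).symm
  exact stub_roughNull v _ hv hw hae (bounded_periodicBEC_of_seed hSeed hG _ hw hwb)

/-- **Skeleton v6 closed modulo its two open stubs**: the crux from the SEED and the singular rest (registered
sub-goal; the five device / twin stubs are discharged by their landed proofs). -/
theorem GDTransfer_of_seed_of_singularRest : Summit.AtomisticToContinuum.BoseEinsteinCondensation.Cruxes.GDTransfer.Seeded.Sig.stub_noBalancedCat → Summit.AtomisticToContinuum.BoseEinsteinCondensation.Cruxes.GDTransfer.Seeded.Sig.stub_singularRest → Summit.AtomisticToContinuum.BoseEinsteinCondensation.Theses.BECThomsonPrinciple.GDTransfer :=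
  fun hSeed hRest => GDTransfer_of_transport hSeed stub_bandEmptinessBdd stub_pairPotentialBound stub_dilationL1
    stub_scaledCloseBdd stub_localConstancyBdd hRest

/-- v6 refines v5: the v5 rest stub follows from the v6 rest stub (its own hypotheses supply GD and the seed, which
feed `bounded_periodicBEC_of_seed`; `essentiallyRough_of_transport`). -/
theorem essentiallyRough_of_singularRest (hRest : Sig.stub_singularRest) : Sig.stub_essentiallyRough :=
  essentiallyRough_of_transport (fun hG hSeed => bounded_periodicBEC_of_seed hSeed hG) hRest

/-- Conversely both open stubs are implied by the crux (so neither can be refuted short of refuting `GDTransfer`):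
the rest by `singularRest_of_gdTransfer`; recorded here as the pair. -/
theorem singularRest_and_soft_of_gdTransfer (h : GDTransfer) :
    Sig.stub_singularRest ∧ (GaussianDominationCan →
      ∀ v : ℝ → ℝ≥0∞, IsRepulsiveFiniteRange v → IsBoundedProfile v → PeriodicBECFor v) :=
  ⟨singularRest_of_gdTransfer h, fun hG v hv _ => (gdTransfer_iff.mp h) hG v hv⟩

end Summit.AtomisticToContinuum.BoseEinsteinCondensation.Cruxes.GDTransfer.Seeded

end
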